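import Summits.BirchSwinnertonDyer.BirchSwinnertonDyer.Theorems.AdditiveKolyvaginRoadLevelSystemsOfSeedCrux
import Summits.BirchSwinnertonDyer.BirchSwinnertonDyer.Theorems.AdditiveKolyvaginRoadLevelSystemsCoreConnectedOfPoitouTate
import Summits.BirchSwinnertonDyer.BirchSwinnertonDyer.Theorems.AdditiveKolyvaginRoadLevelSystemsSelmerBottom
import HarnessLib

/-!
# Route `AdditiveKolyvaginRoad`, crux `LevelKolyvaginSystemsAdditive` (item stmt-BirchSwinnertonDyer-21396, KS′):
# THE CRUX BY NAME from a bipartite SEED datum, granted PUB ∕ DUAL ONLY — the two E-side binders of width seat w2 g2's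
# part 8 ((R′) one-prime raising and `selmer_bottom`) DISCHARGED
# (cell `pub/bsd-wall`, width seat `bsd-wall-akr-p2x-w3` g3; `--supports stmt-BirchSwinnertonDyer-21396`, helper; inside the route
# file's import cone by nature — the conclusion IS the route decl)

WHAT. `levelKolyvaginSystemsAdditive_of_seed_free`: w2 g2's `levelKolyvaginSystemsAdditive_of_seed` (p592803, part 8 of the
rigidity chain: KS′ BY NAME ⟸ PUB ∧ DUAL ∧ (R′) ∧ SEED DATUM) with
* the ∀-frame hypothesis (R′) `hR` (witness-free one-prime raising, W. Zhang Lemma 5.3 raising half with the sign read through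
  (Equiv)) DISCHARGED by this seat's `selQP_raise_free` (`…CoreConnectedOfPoitouTate`, on `…AdmissibleRaiseFree` and the local
  (Trans) `…ToricTransLocal`) fed with the Poitou–Tate conjunct `hDual.2` of `PublishedDualityInputsAdditiveKoly`;
* the conjunct `selmer_bottom` of the seed datum («the conductor-one bottom class `κ₀ ∅ ∅` is a signed Selmer class») DISCHARGED
  by this seat's `selmer_bottom_of_realisation` (`…LevelSystemsSelmerBottom`: `c(1) = δ(y_K) ∈ Sel_∅^{−w(E)}` from the realisation
  identity, Gross (4.4), the proved reflection fact and `E(K)[p] = 0`).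
KERNEL READING. KS′ (`LevelKolyvaginSystemsAdditive`) ⟸ `PublishedInputsAdditiveKoly` ∧ `PublishedDualityInputsAdditiveKoly` ∧ — at
every ♯ additive frame and complex conjugation — a SEED DATUM consisting ONLY of: signs `ε₀`, EVEN-level classes `κ₀` realised by
Kolyvagin–Heegner data at level `∅` and satisfying the carrier's local axioms and the relation (8.1) at non-empty even levels,
ODD-level values `λ`, the Bertolini–Darmon laws (A), (B) TWO-SIDED, and ONE seed at a level `n₀` of total canonical rank `≤ 1`.
Every E-side binder of the rigidity chain (connectivity, parity, (R′), `selmer_bottom`) is now a theorem of the tree modulo the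
route's displayed published inputs. What remains is the crux's open content: the bipartite system at `p²`-level (K1 + the
multiplicity-one input behind the two-sided laws) and ONE seed. (w2 g2's later variant `levelKolyvaginSystemsAdditive_of_seed_ne`,
p594019, removed `selmer_bottom` at the price of a seed at a NON-EMPTY level and still asked (R′); the present statement asks
neither and allows the seed at ANY level of total rank `≤ 1`, `∅` included.)

HONEST FRAMING: one theorem; 0 definitions, 0 named facts, 0 `sorry`; CONDITIONAL on PUB ∕ DUAL (by name) and the seed datum;
closes nothing. BSD is not proved by any of this.

References: [cite: Howard2006Bipartite, Prop. 2.4.11, Thm. 2.5.1] [cite: WZhang2014, §3, Thm. 4.3, (4.8), Lemma 5.3, Prop. 5.4,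
Thm. 7.2, Thm. 9.2, §9] [cite: BertoliniDarmon2005, Lemma 2.6, Thm. 4.1, Thm. 4.2] [cite: GrossLMS1991, §4 (4.4), Prop. 5.3, §10]
[cite: Darmon2004, Prop. 3.11].
-/

-- single-conjunct summit: `Summit.BirchSwinnertonDyer.BirchSwinnertonDyer.…` repeats the name by design
set_option linter.dupNamespace false

noncomputable section

open scoped Classical

namespace Summit.BirchSwinnertonDyer.BirchSwinnertonDyer.Theorems.AdditiveKoly

open WeierstrassCurve NumberField IsDedekindDomain
  Literature.NumberTheory.EllipticCurves Literature.NumberTheory.EllipticCurves.ModularForms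
  Literature.NumberTheory.EllipticCurves.Rank1Residual Literature.NumberTheory.GaloisRepresentations Module
  Summit.BirchSwinnertonDyer.Rank1Residual.X11b.Three.Koly
  Summit.BirchSwinnertonDyer.BirchSwinnertonDyer.Theses.AdditiveKolyvaginRoad

/-- **KS′ BY NAME FROM A SEED DATUM, granted PUB ∕ DUAL only.** At every ♯ additive frame of the route and every complex
conjugation `c ≠ 1` let there be a SEED DATUM — signs, even-level classes with the realisation identity and the local
Kolyvagin-system axioms at even non-empty levels, odd-level values, the laws (A), (B) two-sided, and ONE seed at a level of
total canonical rank `≤ 1` (NO `selmer_bottom`, NO (R′): both are theorems of the tree now). Then, granted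
`PublishedInputsAdditiveKoly` and `PublishedDualityInputsAdditiveKoly`, the crux `LevelKolyvaginSystemsAdditive` holds.
Proof: w2 g2's `levelKolyvaginSystemsAdditive_of_seed` with `hR := selQP_raise_free … (hDual.2 K)` and the `selmer_bottom`
conjunct supplied by `selmer_bottom_of_realisation`. [cite: WZhang2014, §3, Thm. 4.3, Lemma 5.3, Thm. 7.2, Thm. 9.2, §9]
[cite: Howard2006Bipartite, Thm. 2.5.1] [cite: BertoliniDarmon2005, Lemma 2.6, Thm. 4.1, Thm. 4.2] [cite: GrossLMS1991, §4 (4.4)] -/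
theorem levelKolyvaginSystemsAdditive_of_seed_free (hPUB : PublishedInputsAdditiveKoly)
    (hDual : PublishedDualityInputsAdditiveKoly)
    (H : ∀ (W : WeierstrassCurve ℚ) [W.IsElliptic] [W.IsGloballyMinimal] [NeZero (W.conductorNorm ℤ)]
      (p : ℕ) [Fact p.Prime] (K : Type) [Field K] [NumberField K]
      (Dt : ModularParametrizationData W (W.conductorNorm ℤ)) (β : ℤ) (ι : K →+* ℂ),
      5 ≤ p → Addv W p → W.HasSurjectiveModNGaloisRep p →
      (∀ (ℓ : ℕ) [Fact ℓ.Prime], W.HasMultiplicativeReductionAtPrime ℓ →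
        ¬ p ∣ padicValInt ℓ W.minimalDiscriminantInt) →
      (∃ (ℓ₁ ℓ₂ : ℕ) (_ : Fact ℓ₁.Prime) (_ : Fact ℓ₂.Prime), ℓ₁ ≠ ℓ₂ ∧
        W.HasMultiplicativeReductionAtPrime ℓ₁ ∧ W.HasMultiplicativeReductionAtPrime ℓ₂) →
      ¬ p ∣ W.tamagawaProduct → W.analyticRank = 1 →
      IsImaginaryQuadratic K → Odd (NumberField.discr K) → NumberField.discr K < -4 →
      SatisfiesHeegnerHypothesis (W.conductorNorm ℤ) K →
      (W.quadraticTwist (NumberField.discr K : ℚ)).entireLFunction 1 ≠ 0 →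
      (4 * (W.conductorNorm ℤ : ℤ)) ∣ β ^ 2 - NumberField.discr K → ¬ (p : ℤ) ∣ Dt.c →
      ∀ (c : K ≃ₐ[ℚ] K), c ≠ 1 → ∀ [Module (ZMod p) (Vp W K p)],
      ∃ (ε₀ : Finset (AdmQ W K p) → Bool)
        (κ₀ : Finset {ℓ // Zhang2014.IsKolyvaginPrime (W.conductorNorm ℤ) W K p ℓ} → Finset (AdmQ W K p) → Vp W K p)
        (lam : Finset {ℓ // Zhang2014.IsKolyvaginPrime (W.conductorNorm ℤ) W K p ℓ} → Finset (AdmQ W K p) → ZMod p)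
        (n₀ : Finset (AdmQ W K p)),
        -- realisation at level `∅`
        (∀ m : Finset {ℓ // Zhang2014.IsKolyvaginPrime (W.conductorNorm ℤ) W K p ℓ},
          ∃ d : KolyvaginHeegnerData Dt β ι (∏ ℓ ∈ m, (ℓ : ℕ)), κ₀ m ∅ = d.kolyvaginClass (Fact.out : p.Prime) 1) ∧
        -- sign
        (∀ n : Finset (AdmQ W K p), n.Nonempty → Even n.card →
          ∀ m : Finset {ℓ // Zhang2014.IsKolyvaginPrime (W.conductorNorm ℤ) W K p ℓ},
          conjAct W c ((p ^ 1 : ℕ) : ℤ) (κ₀ m n) = sgnP (ε₀ n ^^ Nat.bodd m.card) • κ₀ m n) ∧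
        -- selmer_off
        (∀ n : Finset (AdmQ W K p), n.Nonempty → Even n.card →
          ∀ (m : Finset {ℓ // Zhang2014.IsKolyvaginPrime (W.conductorNorm ℤ) W K p ℓ}) (v : HeightOneSpectrum (𝓞 K)),
          (∀ ℓ ∈ m, ((ℓ : ℕ) : 𝓞 K) ∉ v.asIdeal) → (∀ q ∈ n, ((q : ℕ) : 𝓞 K) ∉ v.asIdeal) →
          κ₀ m n ∈ selmerLocalKer (W.baseChange K) (v.adicCompletion K) ((p ^ 1 : ℕ) : ℤ)) ∧
        -- selmer_inf
        (∀ n : Finset (AdmQ W K p), n.Nonempty → Even n.card →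
          ∀ (m : Finset {ℓ // Zhang2014.IsKolyvaginPrime (W.conductorNorm ℤ) W K p ℓ}) (w : InfinitePlace K),
          κ₀ m n ∈ selmerLocalKer (W.baseChange K) w.Completion ((p ^ 1 : ℕ) : ℤ)) ∧
        -- toric_on
        (∀ n : Finset (AdmQ W K p), n.Nonempty → Even n.card →
          ∀ m : Finset {ℓ // Zhang2014.IsKolyvaginPrime (W.conductorNorm ℤ) W K p ℓ}, ∀ q ∈ n,
          ∀ v : HeightOneSpectrum (𝓞 K), ((q : ℕ) : 𝓞 K) ∈ v.asIdeal →
          κ₀ m n ∈ toricLocalKer (W.baseChange K) (v.adicCompletion K) ((p ^ 1 : ℕ) : ℤ)) ∧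
        -- transverse_on
        (∀ n : Finset (AdmQ W K p), n.Nonempty → Even n.card →
          ∀ m : Finset {ℓ // Zhang2014.IsKolyvaginPrime (W.conductorNorm ℤ) W K p ℓ}, ∀ ℓ ∈ m,
          ∀ v : HeightOneSpectrum (𝓞 K), ((ℓ : ℕ) : 𝓞 K) ∈ v.asIdeal → κ₀ m n ∈ transverseLocalKerP W K p ι ℓ v) ∧
        -- relation (8.1)
        (∀ n : Finset (AdmQ W K p), n.Nonempty → Even n.card →
          ∀ (m : Finset {ℓ // Zhang2014.IsKolyvaginPrime (W.conductorNorm ℤ) W K p ℓ})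
            (ℓ : {ℓ // Zhang2014.IsKolyvaginPrime (W.conductorNorm ℤ) W K p ℓ}), ℓ ∉ m →
          ∀ v : HeightOneSpectrum (𝓞 K), ((ℓ : ℕ) : 𝓞 K) ∈ v.asIdeal →
          (κ₀ (insert ℓ m) n ∈ (W.baseChange K).torsionLocalKer (v.adicCompletion K) ((p ^ 1 : ℕ) : ℤ) ↔
            κ₀ m n ∈ (W.baseChange K).torsionLocalKer (v.adicCompletion K) ((p ^ 1 : ℕ) : ℤ))) ∧
        -- law (A), TWO-SIDED: the value one level up is a unit iff the class is detected at the NEW prime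
        (∀ (n : Finset (AdmQ W K p)) (q : AdmQ W K p), Even n.card → q ∉ n →
          ∀ m : Finset {ℓ // Zhang2014.IsKolyvaginPrime (W.conductorNorm ℤ) W K p ℓ},
          lam m (insert q n) ≠ 0 ↔ ∃ v : HeightOneSpectrum (𝓞 K), ((q : ℕ) : 𝓞 K) ∈ v.asIdeal ∧
            κ₀ m n ∉ (W.baseChange K).torsionLocalKer (v.adicCompletion K) ((p ^ 1 : ℕ) : ℤ)) ∧
        -- law (B), TWO-SIDED: the class is detected at a LEVEL prime iff the value one level down is a unit
        (∀ (n : Finset (AdmQ W K p)) (q : AdmQ W K p), Odd n.card → q ∉ n →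
          ∀ m : Finset {ℓ // Zhang2014.IsKolyvaginPrime (W.conductorNorm ℤ) W K p ℓ},
          (∃ v : HeightOneSpectrum (𝓞 K), ((q : ℕ) : 𝓞 K) ∈ v.asIdeal ∧
            κ₀ m (insert q n) ∉ (W.baseChange K).torsionLocalKer (v.adicCompletion K) ((p ^ 1 : ℕ) : ℤ)) ↔
            lam m n ≠ 0) ∧
        -- ONE seed at a level of total canonical rank ≤ 1
        finrank (ZMod p) (SelQP W K p c n₀ true) + finrank (ZMod p) (SelQP W K p c n₀ false) ≤ 1 ∧
        ((Even n₀.card ∧ κ₀ ∅ n₀ ≠ 0) ∨ (Odd n₀.card ∧ lam ∅ n₀ ≠ 0))) :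
    LevelKolyvaginSystemsAdditive := by
  refine levelKolyvaginSystemsAdditive_of_seed hPUB hDual
    (fun W _ _ p _ K _ _ c _ h5 hK hc1 ↦ selQP_raise_free W K p hK (by omega) c (hDual.2 K)) ?_
  intro W _ _ _ p _ K _ _ Dt β ι h5 hadd hsurj hsp htwo htam hr hK hodd hlt hH hL hβ hcM c hc1 _
  obtain ⟨ε₀, κ₀, lam, n₀, hreal, hsign, hoff, hinf, htor, htr, hrel, hA, hB, hcore₀, hseed⟩ :=
    H W p K Dt β ι h5 hadd hsurj hsp htwo htam hr hK hodd hlt hH hL hβ hcM c hc1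
  exact ⟨ε₀, κ₀, lam, n₀, hreal, hsign, hoff, hinf, htor, htr, hrel, hA, hB,
    selmer_bottom_of_realisation W p K Dt β ι hsurj hK hH hc1 κ₀ hreal, hcore₀, hseed⟩

end Summit.BirchSwinnertonDyer.BirchSwinnertonDyer.Theorems.AdditiveKoly

end
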